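import Literature.Probability.RandomPlanarGeometry.SAWSpliceDefs
import HarnessLib

/-!
# The spliced walk: where the lanes and the tail live (geometry for the blob-freeness)

Complement to `SAWSpliceDefs.lean` (surgery of H. Duminil-Copin, G. Kozma, A. Yadin,
*Supercritical self-avoiding walks are space-filling*, Ann. IHP Probab. Stat. 50 (2014), §3):
the sites of the lanes and of the template tail (`Splice.Data.pathSites`) lie in tiles whose
centres are within `ℓ¹`-distance `ρ` of the anchor `g` of the template, as soon as the sphere
radius satisfies `2L ≤ d₀ ≤ ρ` and the tile margin is `r ≥ 4` (`Splice.Data.l1dist_g_ctr_tileOf_le`).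
Since `g` is a vertex of the walk, these tiles are not clear of the walk, so the merged
structure (which lives in clear tiles) avoids the lanes and the tail. Ingredients: the anchor in
the lane frame (`Splice.lp`, `Splice.lq`, `Splice.laneFrame_g`), the tail near the anchor
(`Template.l1dist_tail_g`), and the tile just above the arena in a frame (`Frame.fr_mem_tile_ey`).
-/

noncomputable section

open Finset Literature.Probability.LatticeModels

namespace Literature.Probability.RandomPlanarGeometry.SAW

/-! ### Template complements -/

namespace Template

variable (T : Template)

/-- The anchor is a vertex of any walk to which the template applies. [folklore] -/
theorem g_mem_of_holds {l : List (Site 2)} (h : T.Holds l) : T.g ∈ l := by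
  rcases h.1 with ⟨s, t, hl⟩ | ⟨s, t, hl⟩ <;> rw [← hl] <;> simp [seg]

/-- Tail sites are at `ℓ¹`-distance `2` from the anchor. [folklore] -/
theorem l1dist_tail_g {w : Site 2} (hw : w ∈ T.tail) : l1dist w T.g = 2 := by
  cases hs : T.shape <;> simp only [tail, hs, List.mem_singleton, List.not_mem_nil] at hw <;> subst hw <;>
    rw [g, Frame.l1dist_fr_fr] <;> norm_num [abs_of_nonneg, abs_of_nonpos]

end Template

namespace Splice

/-- The anchor abscissa in the lane frame. [folklore] -/
def lp (T : Template) : ℤ := if T.p ≤ T.q then T.p else T.q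

/-- The anchor ordinate in the lane frame. [folklore] -/
def lq (T : Template) : ℤ := if T.p ≤ T.q then T.q else T.p

/-- The anchor in the lane frame. [folklore] -/
theorem laneFrame_g (T : Template) : T.g = (laneFrame T).fr (lp T) (lq T) := by
  unfold laneFrame lp lq
  split_ifs <;> simp [Template.g, Frame.swap_fr]

/-- The anchor coordinates in the lane frame against the lane pair: `lα ≤ lp ≤ lα + 1`,
`lβ + 1 ≤ lq`, `0 ≤ lp ≤ lq`, `lp + lq = d₀`. [folklore] -/
theorem lp_lq_bounds (T : Template) {d₀ : ℤ} (hd : 0 ≤ d₀) (h : T.WF d₀) :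
    lα T ≤ lp T ∧ lp T ≤ lα T + 1 ∧ lβ T + 1 ≤ lq T ∧ 0 ≤ lp T ∧ lp T ≤ lq T ∧ lp T + lq T = d₀ := by
  unfold lα lβ lp lq
  cases hs : T.shape <;> simp only [Template.WF, hs] at h <;> simp only [Template.α, Template.β, hs] <;>
    split_ifs <;> omega

end Splice

/-! ### The tile beyond the arena in a frame direction -/

namespace Frame

/-- In a frame centred at the centre of the tile `t'`, the sites `fr x y` with `|x| ≤ h`,
`h + 1 ≤ y ≤ 3h + 1` form the tile `t' + ey` (the next tile in the direction `ey`). [folklore] -/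
theorem fr_mem_tile_ey {m r : ℕ} (F : Frame) {t' : Site 2} (hz : F.z₀ = OddTile.ctr m r t') {x y : ℤ}
    (hx : |x| ≤ OddTile.hw m r) (hy : (OddTile.hw m r : ℤ) + 1 ≤ y) (hy' : y ≤ 3 * OddTile.hw m r + 1) :
    F.fr x y ∈ OddTile.tile m r (t' + F.ey) := by
  rw [OddTile.mem_tile_iff, Fin.forall_fin_two]
  simp only [Frame.fr_apply, hz, OddTile.ctr_apply, Pi.add_apply]
  have hL := OddTile.side_eq (m := m) (r := r)
  rw [abs_le] at hx
  rcases F.valid with ⟨h1, h2 | h2⟩ | ⟨h1, h2 | h2⟩ | ⟨h1, h2 | h2⟩ | ⟨h1, h2 | h2⟩ <;>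
    simp only [h1, h2, pt_apply_zero, pt_apply_one, mul_one, mul_zero, mul_neg, add_zero, mul_add] <;>
    constructor <;> constructor <;> nlinarith

/-- The centre of the tile `t' + ey` is `fr 0 L`. [folklore] -/
theorem ctr_add_ey {m r : ℕ} (F : Frame) {t' : Site 2} (hz : F.z₀ = OddTile.ctr m r t') :
    OddTile.ctr m r (t' + F.ey) = F.fr 0 (OddTile.side m r) := by
  funext i
  simp only [OddTile.ctr_apply, Pi.add_apply, Frame.fr_apply, hz, zero_mul, mul_add]
  ring

end Frame

/-! ### Sites of the lanes and the tail are near the anchor's tiles -/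

namespace Splice.Data

variable {m r : ℕ} (X : Data m r)

/-- The top ordinate of the arena rectangle is at least `A = h + r`. [folklore] -/
theorem A_le_yu : A m r ≤ X.Q.yu := by
  have hb := rect_bounds (m := m) (r := r) (laneFrame X.T); simp only [Q]; omega

/-- A lane site with lane-frame coordinates `(x, y)`: either `x + y ≥ L + 1`, or it lies in the
tile above the arena. [folklore] -/
theorem lane_alternative (hr : 4 ≤ r) {w : Site 2} (h0 : 0 ≤ (laneFrame X.T).fx w)
    (h3 : X.Q.yu ≤ (laneFrame X.T).fy w) (hxy : (laneFrame X.T).fx w + (laneFrame X.T).fy w ≤ OddTile.side m r) :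
    OddTile.tileOf m r w = X.t' + (laneFrame X.T).ey := by
  have hhw := OddTile.hw_eq (m := m) (r := r)
  have hside := OddTile.side_eq (m := m) (r := r)
  have hyu := X.A_le_yu
  have hA : A m r = OddTile.hw m r + r := rfl
  have hmem : w ∈ OddTile.tile m r (X.t' + (laneFrame X.T).ey) := by
    rw [← (laneFrame X.T).fr_fx_fy w]
    exact (laneFrame X.T).fr_mem_tile_ey X.hzL (abs_le.2 ⟨by omega, by omega⟩) (by omega) (by omega)
  exact OddTile.mem_tile_iff_tileOf_eq.1 hmem

/-- **Blob-freeness geometry.** Every site of the lanes or of the tail lies in a tile whose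
centre is within `ℓ¹`-distance `ρ` of the anchor, provided `2L ≤ d₀ ≤ ρ` and `r ≥ 4`.
[cite: DuminilCopinKozmaYadin2014, §3 (proof of Proposition 7: the link avoids the untouched boxes)] -/
theorem l1dist_g_ctr_tileOf_le (hr : 4 ≤ r) {ρ : ℤ} (hρ : X.d₀ ≤ ρ) (hL : 2 * (OddTile.side m r : ℤ) ≤ X.d₀)
    {w : Site 2} (hw : w ∈ X.pathSites) :
    l1dist X.T.g (OddTile.ctr m r (OddTile.tileOf m r w)) ≤ ρ := by
  have hhw := OddTile.hw_eq (m := m) (r := r)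
  have hside := OddTile.side_eq (m := m) (r := r)
  have htile := OddTile.l1dist_ctr_le_of_mem_tile (OddTile.mem_tile_tileOf (m := m) (r := r) w)
  -- `l1(g, ctr) ≤ l1(w, g) + l1(w, ctr)`
  have tri : l1dist X.T.g (OddTile.ctr m r (OddTile.tileOf m r w)) ≤
      l1dist w X.T.g + l1dist w (OddTile.ctr m r (OddTile.tileOf m r w)) := by
    simp only [l1dist]
    have := abs_sub_le (X.T.g 0) (w 0) (OddTile.ctr m r (OddTile.tileOf m r w) 0)
    have := abs_sub_le (X.T.g 1) (w 1) (OddTile.ctr m r (OddTile.tileOf m r w) 1)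
    have := abs_sub_comm (X.T.g 0) (w 0); have := abs_sub_comm (X.T.g 1) (w 1)
    omega
  obtain ⟨b1, b2, b3, b4, b5, b6⟩ := lp_lq_bounds X.T (by have := X.three_le_d₀; omega) X.wf
  have hyu := X.A_le_yu
  have hA : A m r = OddTile.hw m r + r := rfl
  have hg := laneFrame_g X.T
  -- the key estimate for a lane site with coordinates `(x, y)`, `0 ≤ x ≤ lα+1`, `yu ≤ y ≤ lβ+1`
  have lane_case : ∀ w : Site 2, 0 ≤ (laneFrame X.T).fx w → (laneFrame X.T).fx w ≤ lα X.T + 1 →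
      X.Q.yu ≤ (laneFrame X.T).fy w → (laneFrame X.T).fy w ≤ lβ X.T + 1 →
      l1dist X.T.g (OddTile.ctr m r (OddTile.tileOf m r w)) ≤ ρ := by
    intro w h1 h2 h3 h4
    have hwfr : w = (laneFrame X.T).fr ((laneFrame X.T).fx w) ((laneFrame X.T).fy w) :=
      ((laneFrame X.T).fr_fx_fy w).symm
    have htile' := OddTile.l1dist_ctr_le_of_mem_tile (OddTile.mem_tile_tileOf (m := m) (r := r) w)
    have tri' : l1dist X.T.g (OddTile.ctr m r (OddTile.tileOf m r w)) ≤
        l1dist w X.T.g + l1dist w (OddTile.ctr m r (OddTile.tileOf m r w)) := by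
      simp only [l1dist]
      have := abs_sub_le (X.T.g 0) (w 0) (OddTile.ctr m r (OddTile.tileOf m r w) 0)
      have := abs_sub_le (X.T.g 1) (w 1) (OddTile.ctr m r (OddTile.tileOf m r w) 1)
      have := abs_sub_comm (X.T.g 0) (w 0); have := abs_sub_comm (X.T.g 1) (w 1)
      omega
    have hdist : l1dist w X.T.g ≤ X.d₀ + 2 - (laneFrame X.T).fx w - (laneFrame X.T).fy w := by
      rw [hwfr, hg, Frame.l1dist_fr_fr, Frame.fx_fr, Frame.fy_fr]
      have a1 := abs_cases ((laneFrame X.T).fx w - lp X.T)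
      have a2 := abs_cases ((laneFrame X.T).fy w - lq X.T)
      omega
    by_cases hfar : (OddTile.side m r : ℤ) + 1 ≤ (laneFrame X.T).fx w + (laneFrame X.T).fy w
    · omega
    · rw [X.lane_alternative hr h1 h3 (by omega), (laneFrame X.T).ctr_add_ey X.hzL, hg, Frame.l1dist_fr_fr,
        abs_of_nonneg (by omega), abs_of_nonneg (by omega)]
      omega
  rw [X.mem_pathSites] at hw
  rcases hw with hw | hw | hw
  · obtain ⟨h1, h2, h3, h4, -⟩ := X.LD.mem_laneL hw
    simp only [LD] at h1 h2 h3 h4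
    exact lane_case w h1 (by omega) h3 h4
  · obtain ⟨h1, h2, h3, h4, -⟩ := X.LD.mem_laneR hw
    simp only [LD] at h1 h2 h3 h4
    exact lane_case w (by omega) h2 h3 (by omega)
  · -- tail: distance `2` from the anchor
    have := X.T.l1dist_tail_g hw
    omega

/-- Sites of the lanes and the tail are within `ℓ¹`-distance `d₀` of the centre. [folklore] -/
theorem l1dist_le_of_mem_pathSites {w : Site 2} (hw : w ∈ X.pathSites) : l1dist w X.T.F.z₀ ≤ X.d₀ := by
  rw [X.mem_pathSites] at hw
  rcases hw with hw | hw | hw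
  · have := X.l1dist_lane (Or.inl hw); omega
  · have := X.l1dist_lane (Or.inr hw); omega
  · exact ((X.T.geom X.three_le_d₀ X.wf).2.2.2.2.2.1 w hw).le

end Splice.Data

end Literature.Probability.RandomPlanarGeometry.SAW
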